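import Literature.Probability.RandomPlanarGeometry.OneSidedExcursionCloud
import Literature.Probability.RandomPlanarGeometry.RestrictionReflection
import Literature.Probability.RandomPlanarGeometry.OneSidedRestrictionProofs
import Literature.Probability.Process.PoissonCloudProofs
import Literature.Probability.RandomPlanarGeometry.HullApproximation
import HarnessLib

/-!
# The left-filled cloud of hung restriction samples is `P⁺_β`, and it charges `i` (Lawler 2005, Prop. 9.13 and Cor. 9.11)

Topic `Probability/RandomPlanarGeometry`. Piece 3 (second half) of the construction
of the right-sided restriction measures `P⁺_β` of Lawler–Schramm–Werner (2003) §8 (**[LSW]**)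
from a two-sided restriction measure `P` of exponent `1` with interior points, after

* G. F. Lawler, *Conformally Invariant Processes in the Plane* (2005) (**[Law05]**), §9.2
  Prop. 9.13 (p. 220): "If `λ > 0`, we can take a Poissonian realization from the measure `μ`.
  Let `K_λ` denote the element of `𝒥₊` obtained by 'left-filling' in the union of all curves in
  the realization […] the probability that this realization avoids `A ∈ 𝒬₊` is
  `exp{−λ|μ(A)|} > 0`. […] `K_λ` has the distribution `P⁺_{cλ}`", and the proof of Cor. 9.11
  (p. 219, = [LSW] Cor. 8.6): "Let `q(α)` be the probability that `i` lies in the hull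
  distributed according to `P⁺_α`. The construction above shows that `q(α) ∈ (0, 1)`".

With the intensity `Λ_β` of `OneSidedExcursionCloud` (the explicit constant: `Λ_β(hit A) =
β(−log Φ'_A(0))`) a Poissonian realization `X` exists by Kingman's theorem (the tree's
`exists_isPoissonCloud_holds`), and (all PROVED):

* `cloudSet X ω = (−∞, 0] ∪ ⋃_{e ∈ X ω} (hung set of e)`; on the almost sure event `goodSet X`
  (all parameters good, finitely many hung sets meet each covering hull `A_n`) it is closed,
  connected, unbounded, in `ℍ̄`, contains `0` and misses `(0, ∞)`, so its left filling is an
  element `cloudConfig X ω` of `Ω₊` (`leftFilling_mem_rightConfigs`);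
* `cloudConfig_mem_avoid_iff` — the left-filled cloud avoids `A ∈ 𝒬₊` iff no cloud point hits
  `A`; hence `cloudConfig` is measurable and **its law is `P⁺_β`**
  (`isRightRestrictionMeasure_map_cloudConfig`: `P'[avoid A] = exp(−Λ_β(hit A)) = Φ'_A(0)^β`);
* `measure_I_mem_cloudConfig_pos` — **`P'{i ∈ K} > 0`**: if `P`-a.e. sample has an interior
  point, some disc `B₀` in the open left quadrant lies in the sample with positive probability
  (reflection invariance of `P`, [LSW] Rem. 3.7), the parameters `((x, y), a)` with
  `a · m_{x',y'}⁻¹(i) ∈ B₀` form a nonempty open set `U` (every point `u + iv`, `u < −a`, is an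
  `a · m⁻¹(i)`), and a cloud point in `U × {B₀ ⊆ K}` (positive intensity) puts `i` in a hung set;
* `exists_isRightRestrictionMeasure_charging_I` — hence **for every `β > 0` there is a
  right-sided restriction measure of exponent `β` giving `{i ∉ K}` probability `< 1`**, from the
  existence of a two-sided `P_1` with interior points — which the tree derives from the §7
  leaves of [LSW] Thm. 7.3 (`exists_isRestrictionMeasure_ae_interior_nonempty_of_three_leaves`);
* the sibling proof file `RestrictionMeasuresFiveEighthsFourLeaves` then feeds this into the
  tree's reductions: [LSW] Prop. 8.1 from the §7 leaves, the comparison sentence of [LSW] p. 38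
  from the martingale leaf and the §7 leaves, and [LSW] p. 5 result 2 from four leaves.

No new named fact (Prop definition) is introduced.
-/

noncomputable section

open Set Filter Topology Complex MeasureTheory Metric
open UpperHalfPlane (upperHalfPlaneSet)
open Literature.Probability.Process (IsPoissonCloud exists_isPoissonCloud_holds)
open scoped ComplexConjugate ENNReal Pointwise

namespace Literature.Probability.RandomPlanarGeometry

namespace ExcursionCloud

variable {Ω' : Type*} (X : Ω' → Set (((ℝ × ℝ) × ℝ) × RestrictionConfig))

/-! ### The random set and the good samples -/

/-- **The cloud set** `(−∞, 0] ∪ ⋃_{e ∈ X ω} (hung set of e)` ([Law05] §9.2: "the union of all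
curves in the realization", together with the half-line they hang on). [cite: Lawler2005, §9.2 Prop. 9.13 (p. 220)] -/
def cloudSet (ω : Ω') : Set ℂ := nonposAxis ∪ ⋃ e ∈ X ω, hungSet e

/-- **The good samples**: every cloud point has good parameters, and only finitely many hung
sets meet each covering hull `A_n` (local finiteness). [folklore] -/
def goodSet : Set Ω' := {ω | (∀ e ∈ X ω, e.1 ∈ goodParams) ∧ ∀ n : ℕ, (X ω ∩ hitSet (coverHull n)).Finite}

variable {X}

/-- The cloud set lies in the closed upper half-plane. [folklore] -/
theorem cloudSet_subset {ω : Ω'} (hω : ω ∈ goodSet X) : cloudSet X ω ⊆ {z : ℂ | 0 ≤ z.im} := by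
  rintro z (hz | hz)
  · exact ((mem_nonposAxis_iff.1 hz).1).ge
  · obtain ⟨e, he, hze⟩ := mem_iUnion₂.1 hz
    exact le_of_lt (show 0 < z.im from hungSet_subset_upperHalfPlaneSet (hω.1 e he) hze)

/-- `0 ∈` cloud set. [folklore] -/
theorem zero_mem_cloudSet (ω : Ω') : (0 : ℂ) ∈ cloudSet X ω :=
  Or.inl ⟨0, mem_Iic.2 le_rfl, by simp⟩

/-- The cloud set is unbounded. [folklore] -/
theorem not_isBounded_cloudSet (ω : Ω') : ¬ Bornology.IsBounded (cloudSet X ω) := fun h ↦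
  not_isBounded_nonposAxis (h.subset subset_union_left)

/-- The cloud set misses `(0, ∞)`. [folklore] -/
theorem ofReal_notMem_cloudSet {ω : Ω'} (hω : ω ∈ goodSet X) {t : ℝ} (ht : 0 < t) : (t : ℂ) ∉ cloudSet X ω := by
  rintro (h | h)
  · exact absurd (mem_nonposAxis_iff.1 h).2 (not_le.2 (by simpa using ht))
  · obtain ⟨e, he, hte⟩ := mem_iUnion₂.1 h
    have := hungSet_subset_upperHalfPlaneSet (hω.1 e he) hte
    simp [upperHalfPlaneSet] at this

/-- A hung set with its left foot added is connected (image of the connected `a⁻¹K ∪ {0}` under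
`m`, continuous there). [folklore] -/
theorem isConnected_hungSet_union_foot {e : ((ℝ × ℝ) × ℝ) × RestrictionConfig} (he : e.1 ∈ goodParams) :
    IsConnected (hungSet e ∪ {((min e.1.1.1 e.1.1.2 : ℝ) : ℂ)}) := by
  obtain ⟨hxy, -, ha, -⟩ := goodParams_lt he
  set x' := min e.1.1.1 e.1.1.2 with hx'
  set y' := max e.1.1.1 e.1.1.2 with hy'
  set T : Set ℂ := e.1.2⁻¹ • (e.2 : Set ℂ) with hT
  have ha0 : e.1.2⁻¹ ≠ 0 := inv_ne_zero ha.ne'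
  have hTH : T ⊆ upperHalfPlaneSet := by
    rintro _ ⟨k, hk, rfl⟩
    show 0 < (e.1.2⁻¹ • k).im
    rw [Complex.real_smul, Complex.mul_im, Complex.ofReal_re, Complex.ofReal_im]
    simpa using mul_pos (inv_pos.2 ha) (show 0 < k.im from e.2.subset_upperHalfPlaneSet hk)
  -- `T ∪ {0}` is connected
  have hTc : IsConnected T := by
    rw [hT]
    exact e.2.isConnected.image _ (continuous_const_smul _).continuousOn
  have hT0 : IsConnected (T ∪ {0}) := by
    refine ⟨⟨0, Or.inr rfl⟩, hTc.isPreconnected.subset_closure subset_union_left ?_⟩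
    rw [hT, closure_smul₀' ha0, e.2.closure_eq_union_zero, Set.smul_set_union, Set.smul_set_singleton, smul_zero]
  -- `m` is continuous on `T ∪ {0}` and maps it onto `hungSet ∪ {x'}`
  have hcont : ContinuousOn (excMap x' y') (T ∪ {0}) := continuousOn_excMap (by
    rintro (h | h)
    · exact ne_neg_one_of_mem_upperHalfPlaneSet (hTH h) rfl
    · simp at h)
  have himg : excMap x' y' '' (T ∪ {0}) = hungSet e ∪ {(x' : ℂ)} := by
    rw [image_union, image_singleton, excMap_zero, hungSet, ← hx', ← hy', ← hT]
  rw [← himg]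
  exact hT0.image _ hcont

/-- **The cloud set is connected** (every hung set hangs on `(−∞, 0]`). [folklore] -/
theorem isConnected_cloudSet {ω : Ω'} (hω : ω ∈ goodSet X) : IsConnected (cloudSet X ω) := by
  -- write the cloud set as a union of connected sets through `0`
  have heq : cloudSet X ω = ⋃ o : Option (X ω), Option.elim o nonposAxis
      (fun e ↦ nonposAxis ∪ (hungSet (e : ((ℝ × ℝ) × ℝ) × RestrictionConfig) ∪ {((min e.1.1.1.1 e.1.1.1.2 : ℝ) : ℂ)})) := by
    ext z
    simp only [cloudSet, mem_union, mem_iUnion]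
    constructor
    · rintro (h | ⟨e, he, hz⟩)
      · exact ⟨none, h⟩
      · exact ⟨some ⟨e, he⟩, Or.inr (Or.inl hz)⟩
    · rintro ⟨_ | e, h⟩
      · exact Or.inl h
      · rcases h with h | h | h
        · exact Or.inl h
        · exact Or.inr ⟨e, e.2, h⟩
        · exact Or.inl (h ▸ (feet_mem_nonposAxis (hω.1 e e.2)).1)
  rw [heq]
  refine ⟨⟨0, mem_iUnion.2 ⟨none, ⟨0, mem_Iic.2 le_rfl, by simp⟩⟩⟩, isPreconnected_iUnion ⟨0, mem_iInter.2 fun o ↦ ?_⟩ fun o ↦ ?_⟩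
  · rcases o with _ | e
    · exact ⟨0, mem_Iic.2 le_rfl, by simp⟩
    · exact Or.inl ⟨0, mem_Iic.2 le_rfl, by simp⟩
  · rcases o with _ | e
    · exact isConnected_nonposAxis.isPreconnected
    · have hx : ((min e.1.1.1.1 e.1.1.1.2 : ℝ) : ℂ) ∈ nonposAxis := (feet_mem_nonposAxis (hω.1 e e.2)).1
      exact (IsConnected.union ⟨_, hx, Or.inr rfl⟩ isConnected_nonposAxis
        (isConnected_hungSet_union_foot (hω.1 e e.2))).isPreconnected

/-- **The cloud set is closed** on the good samples: a limit point `z ∉ (−∞, 0]` has a disc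
`B̄(z, r)` whose part in `ℍ` lies in a covering hull `A_n`, which only finitely many hung sets
meet; so `z` is a limit point of finitely many hung sets, each closed up to its feet on
`(−∞, 0]` (`closure_hungSet_subset`). [folklore] -/
theorem isClosed_cloudSet {ω : Ω'} (hω : ω ∈ goodSet X) : IsClosed (cloudSet X ω) := by
  refine isClosed_of_closure_subset fun z hz ↦ ?_
  by_cases hzn : z ∈ nonposAxis
  · exact Or.inl hzn
  have him : 0 ≤ z.im := by
    have : closure (cloudSet X ω) ⊆ {w : ℂ | 0 ≤ w.im} :=
      closure_minimal (cloudSet_subset hω) (isClosed_le continuous_const Complex.continuous_im)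
    exact this hz
  obtain ⟨n, r, hr, hsub⟩ := exists_closedBall_inter_subset_coverHull him hzn
  set F : Set (((ℝ × ℝ) × ℝ) × RestrictionConfig) := X ω ∩ hitSet (coverHull n) with hF
  have hFfin : F.Finite := hω.2 n
  -- `z` is a limit point of the finite union of the hung sets meeting `A_n`
  have hz' : z ∈ closure (⋃ e ∈ F, hungSet e) := by
    rw [mem_closure_iff_nhds]
    intro V hV
    have hV' : V ∩ ball z r ∩ nonposAxisᶜ ∈ 𝓝 z :=
      inter_mem (inter_mem hV (ball_mem_nhds z hr)) (isClosed_nonposAxis.isOpen_compl.mem_nhds hzn)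
    obtain ⟨w, ⟨⟨hwV, hwr⟩, hwn⟩, hwC⟩ := mem_closure_iff_nhds.1 hz _ hV'
    rcases hwC with hw | hw
    · exact absurd hw hwn
    obtain ⟨e, he, hwe⟩ := mem_iUnion₂.1 hw
    have heg : e.1 ∈ goodParams := hω.1 e he
    have hwH : w ∈ upperHalfPlaneSet := hungSet_subset_upperHalfPlaneSet heg hwe
    have hwA : w ∈ coverHull n := hsub ⟨ball_subset_closedBall hwr, hwH⟩
    have heF : e ∈ F := by
      refine ⟨he, heg, fun hd ↦ ?_⟩
      exact Set.disjoint_left.1 ((hungSet_disjoint_iff (isPlusHull_coverHull n) heg).2 hd) hwe hwA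
    exact ⟨w, hwV, mem_iUnion₂.2 ⟨e, heF, hwe⟩⟩
  rw [hFfin.closure_biUnion] at hz'
  obtain ⟨e, heF, hze⟩ := mem_iUnion₂.1 hz'
  have heg : e.1 ∈ goodParams := hω.1 e heF.1
  rcases closure_hungSet_subset heg hze with h | h
  · exact Or.inr (mem_iUnion₂.2 ⟨e, heF.1, h⟩)
  · rcases h with h | h
    · exact Or.inl (h ▸ (feet_mem_nonposAxis heg).1)
    · exact Or.inl (h ▸ (feet_mem_nonposAxis heg).2)

/-- **The left-filled cloud is an element of `Ω₊`** on the good samples ([Law05] §9.2: "the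
element of `𝒥₊` obtained by 'left-filling' in the union of all curves").
[cite: Lawler2005, §9.2 Prop. 9.13 (p. 220)] -/
theorem leftFilling_cloudSet_mem {ω : Ω'} (hω : ω ∈ goodSet X) : leftFilling (cloudSet X ω) ∈ rightConfigs :=
  leftFilling_mem_rightConfigs (isClosed_cloudSet hω) (cloudSet_subset hω) (isConnected_cloudSet hω)
    (zero_mem_cloudSet ω) (not_isBounded_cloudSet ω) fun _ ht ↦ ofReal_notMem_cloudSet hω ht

open Classical in
/-- **The `Ω₊`-valued version of the left-filled cloud** (`(−∞, 0]` off the good samples). [cite: Lawler2005, §9.2 Prop. 9.13 (p. 220)] -/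
def cloudConfig (X : Ω' → Set (((ℝ × ℝ) × ℝ) × RestrictionConfig)) (ω : Ω') : RightConfig :=
  if h : ω ∈ goodSet X then ⟨leftFilling (cloudSet X ω), leftFilling_cloudSet_mem h⟩ else RightConfig.negAxis

/-- On the good samples the version is the left-filled cloud. [folklore] -/
theorem coe_cloudConfig {ω : Ω'} (hω : ω ∈ goodSet X) :
    ((cloudConfig X ω : RightConfig) : Set ℂ) = leftFilling (cloudSet X ω) := by
  rw [cloudConfig, dif_pos hω]

/-- **The left-filled cloud avoids `A ∈ 𝒬₊` iff no cloud point hits `A`** (the left filling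
avoids a `+`-hull iff the filled set does, `disjoint_leftFilling_iff_of_isPlusHull`; the hung
set of `e` misses `A` iff `e ∉ hit A`, `hungSet_disjoint_iff`). [folklore] -/
theorem disjoint_leftFilling_cloudSet_iff {ω : Ω'} (hω : ω ∈ goodSet X) {A : Set ℂ} (hA : IsPlusHull A) :
    Disjoint (leftFilling (cloudSet X ω)) A ↔ X ω ∩ hitSet A = ∅ := by
  rw [disjoint_leftFilling_iff_of_isPlusHull (fun _ ht ↦ ofReal_notMem_cloudSet hω ht) hA, cloudSet,
    disjoint_union_left, disjoint_iUnion₂_left, eq_empty_iff_forall_notMem]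
  constructor
  · rintro ⟨-, h⟩ e ⟨he, -, hnd⟩
    exact hnd ((hungSet_disjoint_iff hA (hω.1 e he)).1 (h e he))
  · intro h
    refine ⟨hA.disjoint_nonposAxis.symm, fun e he ↦ (hungSet_disjoint_iff hA (hω.1 e he)).2 ?_⟩
    by_contra hnd
    exact h e ⟨he, hω.1 e he, hnd⟩

/-- The version avoids `A ∈ 𝒬₊` iff no cloud point hits `A`, on the good samples. [folklore] -/
theorem cloudConfig_mem_avoid_iff {ω : Ω'} (hω : ω ∈ goodSet X) {A : Set ℂ} (hA : IsPlusHull A) :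
    cloudConfig X ω ∈ RightConfig.avoid A ↔ X ω ∩ hitSet A = ∅ := by
  rw [RightConfig.mem_avoid, coe_cloudConfig hω, disjoint_leftFilling_cloudSet_iff hω hA]

/-- `(−∞, 0]` avoids every `+`-hull. [folklore] -/
theorem negAxis_mem_avoid {A : Set ℂ} (hA : IsPlusHull A) : RightConfig.negAxis ∈ RightConfig.avoid A := by
  rw [RightConfig.mem_avoid]
  exact hA.disjoint_nonposAxis.symm

/-! ### The Poissonian realization: almost every sample is good; the version is measurable -/

section Cloud

variable {Ω' : Type*} [MeasurableSpace Ω'] {P' : Measure Ω'} {X : Ω' → Set (((ℝ × ℝ) × ℝ) × RestrictionConfig)}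
  {β : ℝ} {P : Measure RestrictionConfig}

/-- The covering hulls are nonempty. [folklore] -/
theorem coverHull_nonempty (n : ℕ) : (coverHull n).Nonempty := by
  refine ⟨1 + Complex.I, coverRect_inter_subset n ⟨Or.inl ?_, by simp [upperHalfPlaneSet]⟩⟩
  have hn : (0 : ℝ) ≤ n := n.cast_nonneg
  have hinv : 1 / ((n : ℝ) + 1) ≤ 1 := by
    rw [div_le_one (by positivity)]
    linarith
  simp only [mem_setOf_eq, Complex.add_re, Complex.one_re, Complex.I_re, add_zero, abs_one, Complex.add_im,
    Complex.one_im, Complex.I_im, zero_add]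
  exact ⟨by linarith, hinv, by linarith⟩

omit [MeasurableSpace Ω'] in
/-- The good set, as an intersection of count events. [folklore] -/
theorem goodSet_eq (X : Ω' → Set (((ℝ × ℝ) × ℝ) × RestrictionConfig)) :
    goodSet X = {ω | X ω ∩ (goodParamsᶜ ×ˢ (univ : Set RestrictionConfig)) = ∅} ∩
      ⋂ n : ℕ, {ω | (X ω ∩ hitSet (coverHull n)).encard ≠ ⊤} := by
  ext ω
  simp only [goodSet, mem_setOf_eq, mem_inter_iff, mem_iInter, encard_ne_top_iff, eq_empty_iff_forall_notMem,
    mem_prod, mem_univ, and_true, mem_compl_iff, not_and, not_not]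

/-- **The good set is measurable.** [folklore] -/
theorem measurableSet_goodSet [SFinite P] (hX : IsPoissonCloud (cloudIntensity β P) X P') : MeasurableSet (goodSet X) := by
  rw [goodSet_eq]
  refine (hX.measurableSet_inter_eq_empty (measurableSet_goodParams.compl.prod MeasurableSet.univ)).inter
    (MeasurableSet.iInter fun n ↦ ?_)
  exact (hX.measurable_encard (measurableSet_hitSet (isPlusHull_coverHull n) (coverHull_nonempty n)))
    (measurableSet_singleton ⊤).compl

/-- **Almost every sample is good** ([Law05] Lemma 9.12: `|μ(A)| < ∞`, so only finitely many
curves of the realization meet each `A_n`; and the parameters are almost surely good since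
`Λ_β` lives on the good parameters). [cite: Lawler2005, §9.2 Lemma 9.12 (p. 220)] -/
theorem ae_mem_goodSet (hP : IsRestrictionMeasure 1 P) (hβ : 0 ≤ β) (hX : IsPoissonCloud (cloudIntensity β P) X P') :
    ∀ᵐ ω ∂P', ω ∈ goodSet X := by
  haveI := hP.isProbabilityMeasure
  haveI := hX.isProbabilityMeasure
  rw [goodSet_eq]
  simp only [mem_inter_iff, mem_iInter, mem_setOf_eq]
  refine Filter.eventually_and.2 ⟨?_, ae_all_iff.2 fun n ↦ ?_⟩
  · -- the parameters: `Λ(bad × Ω) = 0`, so `P'[X ∩ (bad × Ω) = ∅] = e^0 = 1`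
    have hs : MeasurableSet (goodParamsᶜ ×ˢ (univ : Set RestrictionConfig)) := measurableSet_goodParams.compl.prod MeasurableSet.univ
    have hΛ : cloudIntensity β P (goodParamsᶜ ×ˢ (univ : Set RestrictionConfig)) = 0 := by
      rw [cloudIntensity_prod, paramMeasure_compl_goodParams, zero_mul]
    have h1 : P' {ω | X ω ∩ (goodParamsᶜ ×ˢ (univ : Set RestrictionConfig)) = ∅} = 1 := by
      rw [hX.measure_inter_eq_empty hs (by rw [hΛ]; exact ENNReal.zero_ne_top), hΛ]
      simp
    rw [ae_iff]
    have : {ω | ¬ X ω ∩ (goodParamsᶜ ×ˢ (univ : Set RestrictionConfig)) = ∅} =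
        {ω | X ω ∩ (goodParamsᶜ ×ˢ (univ : Set RestrictionConfig)) = ∅}ᶜ := rfl
    rw [this, prob_compl_eq_zero_iff (hX.measurableSet_inter_eq_empty hs), h1]
  · -- local finiteness: `N(hit A_n) ~ Poisson`, which never takes the value `⊤`
    have hs := measurableSet_hitSet (isPlusHull_coverHull n) (coverHull_nonempty n)
    have hfin := cloudIntensity_hitSet_ne_top (isPlusHull_coverHull n) (coverHull_nonempty n) hP hβ
    rw [ae_iff]
    have hset : {ω | ¬ (X ω ∩ hitSet (coverHull n)).encard ≠ ⊤} =
        (fun ω ↦ (X ω ∩ hitSet (coverHull n)).encard) ⁻¹' {⊤} := by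
      ext ω
      simp
    rw [hset, ← Measure.map_apply (hX.measurable_encard hs) (measurableSet_singleton ⊤), hX.map_encard hs hfin,
      Measure.map_apply measurable_from_top (measurableSet_singleton ⊤)]
    have : ((↑) : ℕ → ℕ∞) ⁻¹' {⊤} = ∅ := by
      ext k
      simp
    rw [this, measure_empty]

/-- **The `Ω₊`-valued version is measurable** (the σ-field of `Ω₊` is generated by the
avoidance events of `+`-hulls, whose preimages are count events on the good set). [folklore] -/
theorem measurable_cloudConfig [SFinite P] (hX : IsPoissonCloud (cloudIntensity β P) X P') : Measurable (cloudConfig X) := by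
  refine measurable_generateFrom ?_
  rintro _ ⟨A, hA, rfl⟩
  rcases A.eq_empty_or_nonempty with rfl | hne
  · have : RightConfig.avoid (∅ : Set ℂ) = univ := by
      ext K
      simp [RightConfig.mem_avoid]
    rw [this, preimage_univ]
    exact MeasurableSet.univ
  have hpre : cloudConfig X ⁻¹' RightConfig.avoid A = (goodSet X ∩ {ω | X ω ∩ hitSet A = ∅}) ∪ (goodSet X)ᶜ := by
    ext ω
    simp only [mem_preimage, mem_union, mem_inter_iff, mem_setOf_eq, mem_compl_iff]
    by_cases hω : ω ∈ goodSet X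
    · rw [cloudConfig_mem_avoid_iff hω hA]
      simp [hω]
    · simp only [hω, not_false_eq_true, or_true, iff_true]
      rw [cloudConfig, dif_neg hω]
      exact negAxis_mem_avoid hA
  rw [hpre]
  exact ((measurableSet_goodSet hX).inter (hX.measurableSet_inter_eq_empty (measurableSet_hitSet hA hne))).union
    (measurableSet_goodSet hX).compl

/-- A restriction derivative of the empty hull is `1` (restriction maps of `∅` agree with the
identity). [folklore] -/
theorem eq_one_of_hasRestrictionDeriv_empty {Φ : ConformalEquiv (upperHalfPlaneSet \ ∅) upperHalfPlaneSet}
    (hΦ : IsRestrictionMap ∅ Φ) {d : ℝ} (hd : HasRestrictionDeriv ∅ Φ d) : d = 1 := by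
  obtain ⟨Φ₀, -, huniq⟩ := IsStarHull.existsUnique_isRestrictionMap_holds isStarHull_empty
  have h1 : EqOn Φ Φ₀ (upperHalfPlaneSet \ ∅) := huniq Φ hΦ
  have h2 : EqOn restrictionMapEmpty Φ₀ (upperHalfPlaneSet \ ∅) := huniq _ isRestrictionMap_empty
  have hd' : HasRestrictionDeriv ∅ restrictionMapEmpty d := by
    refine hd.congr' ?_
    filter_upwards [self_mem_nhdsWithin] with z hz
    rw [h1 hz, h2 hz]
  exact HasRestrictionDeriv.unique isStarHull_empty hd' hasRestrictionDeriv_empty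

/-- **The law of the left-filled cloud is `P⁺_β`** ([Law05] Prop. 9.13: "`K_λ` has the
distribution `P⁺_{cλ}`", here with the exponent identified: the avoidance probability is
`P'[X ∩ hit A = ∅] = exp(−Λ_β(hit A)) = exp(β log Φ'_A(0)) = Φ'_A(0)^β`).
[cite: Lawler2005, §9.2 Prop. 9.13 (p. 220)] -/
theorem isRightRestrictionMeasure_map_cloudConfig (hP : IsRestrictionMeasure 1 P) (hβ : 0 ≤ β)
    (hX : IsPoissonCloud (cloudIntensity β P) X P') : IsRightRestrictionMeasure β (P'.map (cloudConfig X)) := by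
  haveI := hP.isProbabilityMeasure
  haveI := hX.isProbabilityMeasure
  have hmeas := measurable_cloudConfig hX (P := P)
  refine ⟨Measure.isProbabilityMeasure_map hmeas.aemeasurable, ?_⟩
  intro A hA Φ hΦ d hd
  rw [Measure.map_apply hmeas (RightConfig.measurableSet_avoid hA)]
  rcases A.eq_empty_or_nonempty with rfl | hne
  · have : RightConfig.avoid (∅ : Set ℂ) = univ := by
      ext K
      simp [RightConfig.mem_avoid]
    rw [eq_one_of_hasRestrictionDeriv_empty hΦ hd, this, preimage_univ, measure_univ]
    simp
  -- off a null set the preimage is the count event `{X ∩ hit A = ∅}`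
  have hae : cloudConfig X ⁻¹' RightConfig.avoid A =ᵐ[P'] {ω | X ω ∩ hitSet A = ∅} := by
    filter_upwards [ae_mem_goodSet hP hβ hX] with ω hω
    show (ω ∈ cloudConfig X ⁻¹' RightConfig.avoid A) = (ω ∈ {ω | X ω ∩ hitSet A = ∅})
    rw [mem_preimage, cloudConfig_mem_avoid_iff hω hA]
    rfl
  have hd0 : 0 < d := by
    obtain ⟨d', hd'0, -, hd'⟩ := IsStarHull.exists_hasRestrictionDeriv_holds hA.1 hΦ
    rwa [HasRestrictionDeriv.unique hA.1 hd hd']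
  rw [measure_congr hae, hX.measure_inter_eq_empty (measurableSet_hitSet hA hne)
      (cloudIntensity_hitSet_ne_top hA hne hP hβ),
    cloudIntensity_hitSet hA hne hP hβ hΦ hd, ENNReal.toReal_ofReal (mul_nonneg hβ ?_),
    Real.rpow_def_of_pos hd0]
  · congr 1
    rw [show -(β * -Real.log d) = Real.log d * β by ring]
  · obtain ⟨d', -, hd'1, hd'⟩ := IsStarHull.exists_hasRestrictionDeriv_holds hA.1 hΦ
    have hd1 : d ≤ 1 := by rwa [HasRestrictionDeriv.unique hA.1 hd hd']
    have : Real.log d ≤ 0 := Real.log_nonpos hd0.le hd1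
    linarith

end Cloud

/-! ### Positivity: the left-filled cloud contains `i` with positive probability -/

section Positivity

variable {P : Measure RestrictionConfig}

/-- `σ(B(d, r)) = B(σ d, r)`. [folklore] -/
theorem imagAxisRefl_image_ball (d : ℂ) (r : ℝ) : imagAxisRefl '' ball d r = ball (imagAxisRefl d) r := by
  ext w
  constructor
  · rintro ⟨z, hz, rfl⟩
    rw [mem_ball, dist_imagAxisRefl]
    exact hz
  · intro hw
    refine ⟨imagAxisRefl w, ?_, imagAxisRefl_imagAxisRefl w⟩
    rw [mem_ball, ← dist_imagAxisRefl, imagAxisRefl_imagAxisRefl]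
    exact hw

/-- The event "`K` contains the mirror disc" is the mirror image of "`K` contains the disc". [folklore] -/
theorem reflect_preimage_ball_subset (d : ℂ) (r : ℝ) :
    RestrictionConfig.reflect ⁻¹' {K : RestrictionConfig | ball d r ⊆ (K : Set ℂ)} =
      {K : RestrictionConfig | ball (imagAxisRefl d) r ⊆ (K : Set ℂ)} := by
  ext K
  simp only [mem_preimage, mem_setOf_eq, RestrictionConfig.coe_reflect, ← imagAxisRefl_image_ball]
  constructor
  · intro h w ⟨z, hz, hzw⟩
    obtain ⟨k, hk, hkz⟩ := h hz
    rw [← hzw, ← hkz, imagAxisRefl_imagAxisRefl]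
    exact hk
  · intro h z hz
    refine ⟨imagAxisRefl z, h ⟨z, hz, rfl⟩, imagAxisRefl_imagAxisRefl z⟩

/-- **From a charged disc with centre in `{re < 0}` to a charged disc inside `{re < 0}`** (shrink
the radius). [folklore] -/
theorem exists_ball_of_charged {d : ℂ} {r : ℝ} (hr : 0 < r) (hd : d.re < 0)
    (hpos : 0 < P {K : RestrictionConfig | ball d r ⊆ (K : Set ℂ)}) :
    ∃ (q₀ : ℂ) (r₀ : ℝ), 0 < r₀ ∧ ball q₀ r₀ ⊆ {z : ℂ | z.re < 0} ∧
      0 < P {K : RestrictionConfig | ball q₀ r₀ ⊆ (K : Set ℂ)} := by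
  refine ⟨d, min r (-d.re), lt_min hr (by linarith), fun w hw ↦ ?_, hpos.trans_le (measure_mono fun K hK ↦ ?_)⟩
  · rw [mem_ball] at hw
    have h1 : |(w - d).re| ≤ ‖w - d‖ := abs_re_le_norm _
    rw [Complex.sub_re, abs_le] at h1
    have h2 : ‖w - d‖ < -d.re := (lt_min_iff.1 (by rwa [dist_eq_norm] at hw)).2
    show w.re < 0
    linarith
  · exact (ball_subset_ball (min_le_left _ _)).trans hK

/-- **A two-sided restriction measure whose samples have interior points charges some disc of the
open left quadrant**: by `P`-a.e. nonemptiness of the interior some rational disc `B(d, r)` lies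
in `K` with positive probability; if `re d > 0` reflect (`P` is `σ`-invariant, [LSW] Rem. 3.7),
if `re d = 0` shift the disc to the left inside itself, then shrink. [cite: LawlerSchrammWerner2003Restriction, Remark 3.7 (p. 14)] -/
theorem exists_ball_re_neg_charged {α : ℝ} (hP : IsRestrictionMeasure α P)
    (hint : ∀ᵐ K : RestrictionConfig ∂P, (interior (K : Set ℂ)).Nonempty) :
    ∃ (q₀ : ℂ) (r₀ : ℝ), 0 < r₀ ∧ ball q₀ r₀ ⊆ {z : ℂ | z.re < 0} ∧
      0 < P {K : RestrictionConfig | ball q₀ r₀ ⊆ (K : Set ℂ)} := by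
  haveI := hP.isProbabilityMeasure
  obtain ⟨D, hDc, hDd⟩ := TopologicalSpace.exists_countable_dense ℂ
  -- every configuration with an interior point contains a rational disc
  have hcov : {K : RestrictionConfig | (interior (K : Set ℂ)).Nonempty} ⊆
      ⋃ d ∈ D, ⋃ m : ℕ, {K : RestrictionConfig | ball d (1 / ((m : ℝ) + 1)) ⊆ (K : Set ℂ)} := by
    rintro K ⟨z, hz⟩
    rw [mem_interior_iff_mem_nhds, Metric.mem_nhds_iff] at hz
    obtain ⟨ε, hε, hball⟩ := hz
    obtain ⟨m, hm⟩ := exists_nat_one_div_lt (half_pos hε)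
    have hpos : (0 : ℝ) < 1 / ((m : ℝ) + 1) := by positivity
    obtain ⟨d, hdD, hdz⟩ := hDd.exists_dist_lt z hpos
    refine mem_iUnion₂.2 ⟨d, hdD, mem_iUnion.2 ⟨m, fun w hw ↦ hball ?_⟩⟩
    rw [mem_ball] at hw ⊢
    calc dist w z ≤ dist w d + dist d z := dist_triangle _ _ _
      _ < 1 / ((m : ℝ) + 1) + 1 / ((m : ℝ) + 1) := by rw [dist_comm d z]; linarith
      _ < ε := by linarith
  have h1 : P {K : RestrictionConfig | (interior (K : Set ℂ)).Nonempty} = 1 := by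
    rw [← prob_compl_eq_zero_iff RestrictionConfig.measurableSet_interior_nonempty]
    rw [ae_iff] at hint
    exact hint
  -- some rational disc is charged
  have hex : ∃ d ∈ D, ∃ m : ℕ, 0 < P {K : RestrictionConfig | ball d (1 / ((m : ℝ) + 1)) ⊆ (K : Set ℂ)} := by
    by_contra h
    push Not at h
    have hnull : P (⋃ d ∈ D, ⋃ m : ℕ, {K : RestrictionConfig | ball d (1 / ((m : ℝ) + 1)) ⊆ (K : Set ℂ)}) = 0 :=
      (measure_biUnion_null_iff hDc).2 fun d hd ↦ measure_iUnion_null_iff.2 fun m ↦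
        nonpos_iff_eq_zero.1 (h d hd m)
    have := measure_mono_null hcov hnull
    rw [h1] at this
    exact one_ne_zero this
  obtain ⟨d, -, m, hpos⟩ := hex
  have hr : (0 : ℝ) < 1 / ((m : ℝ) + 1) := by positivity
  set r : ℝ := 1 / ((m : ℝ) + 1) with hrdef
  rcases lt_trichotomy d.re 0 with hd | hd | hd
  · exact exists_ball_of_charged hr hd hpos
  · -- shift the disc to the left inside itself
    have hsub : ball (d - (r / 2 : ℝ)) (r / 2) ⊆ ball d r := by
      intro w hw
      rw [mem_ball] at hw ⊢
      calc dist w d ≤ dist w (d - (r / 2 : ℝ)) + dist (d - ((r / 2 : ℝ) : ℂ)) d := dist_triangle _ _ _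
        _ < r / 2 + r / 2 := by
            have : dist (d - ((r / 2 : ℝ) : ℂ)) d = r / 2 := by
              rw [dist_eq_norm, sub_sub_cancel_left, norm_neg, Complex.norm_real, Real.norm_eq_abs,
                abs_of_pos (half_pos hr)]
            linarith
        _ = r := by ring
    have hre : (d - ((r / 2 : ℝ) : ℂ)).re < 0 := by
      rw [Complex.sub_re, Complex.ofReal_re, hd]
      linarith
    exact exists_ball_of_charged (half_pos hr) hre (hpos.trans_le (measure_mono fun K hK ↦ hsub.trans hK))
  · -- reflect
    have hpos' : 0 < P {K : RestrictionConfig | ball (imagAxisRefl d) r ⊆ (K : Set ℂ)} := by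
      rw [← reflect_preimage_ball_subset, hP.measure_preimage_reflect (RestrictionConfig.measurableSet_ball_subset d r)]
      exact hpos
    exact exists_ball_of_charged hr (by rw [imagAxisRefl_re]; linarith) hpos'

/-- **Every point `q₀` of the open left quadrant is `a · m_{x,y}⁻¹(i)` for good parameters**:
with `a < −re q₀`, `q₀/a = u + iv`, `u < −1`, `v > 0`, take `y = (u + 1)/v`, `x = −uy − v`
(then `x < y < 0` and `(x − i) = (u + iv)(i − y)`). [folklore] -/
theorem exists_goodParams_eq {q₀ : ℂ} (hre : q₀.re < 0) (him : 0 < q₀.im) :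
    ∃ q ∈ goodParams, (q.2 : ℂ) * excInv (min q.1.1 q.1.2) (max q.1.1 q.1.2) Complex.I = q₀ := by
  set a : ℝ := min (1 / 2) (-q₀.re / 2) with ha
  have ha0 : 0 < a := lt_min (by norm_num) (by linarith)
  have ha1 : a < 1 := (min_le_left _ _).trans_lt (by norm_num)
  have hare : a < -q₀.re := (min_le_right _ _).trans_lt (by linarith)
  set u : ℝ := q₀.re / a with hu
  set v : ℝ := q₀.im / a with hv
  have hu1 : u < -1 := by
    rw [hu, div_lt_iff₀ ha0]
    linarith
  have hv0 : 0 < v := div_pos him ha0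
  set y : ℝ := (u + 1) / v with hy
  set x : ℝ := -u * y - v with hx
  have hy0 : y < 0 := div_neg_of_neg_of_pos (by linarith) hv0
  have hvy : v * y = u + 1 := by rw [hy]; field_simp
  have hxy : x < y := by
    have : x - y = -((u + 1) ^ 2 + v ^ 2) / v := by
      rw [hx, hy]
      field_simp
      ring
    have hneg : x - y < 0 := by
      rw [this]
      exact div_neg_of_neg_of_pos (by nlinarith [sq_nonneg (u + 1), sq_nonneg v]) hv0
    linarith
  refine ⟨((x, y), a), ⟨⟨(hxy.trans hy0 : x < 0), hy0⟩, hxy.ne, ha0, ha1⟩, ?_⟩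
  simp only [min_eq_left hxy.le, max_eq_right hxy.le]
  -- the identity `a (x − i)/(i − y) = q₀`
  have hIy : (Complex.I - (y : ℂ)) ≠ 0 := fun h ↦ by
    have := congrArg Complex.im h
    simp at this
  have hq : q₀ = (a : ℂ) * ((u : ℂ) + (v : ℂ) * Complex.I) := by
    apply Complex.ext
    · simp [hu, hv]
      field_simp
    · simp [hu, hv]
      field_simp
  have hkey : ((x : ℂ) - Complex.I) = ((u : ℂ) + (v : ℂ) * Complex.I) * (Complex.I - (y : ℂ)) := by
    apply Complex.ext
    · simp [hx]
    · simp
      linarith [hvy]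
  rw [excInv, hkey, mul_div_assoc, div_self hIy, mul_one, hq]

/-- The point map `q ↦ a · m_{x',y'}⁻¹(i)` is continuous (its pole `y'` is real, `i` is not). [folklore] -/
theorem continuous_hungPoint_I :
    Continuous fun q : (ℝ × ℝ) × ℝ ↦ (q.2 : ℂ) * excInv (min q.1.1 q.1.2) (max q.1.1 q.1.2) Complex.I := by
  have h1 : Continuous fun q : (ℝ × ℝ) × ℝ ↦ ((min q.1.1 q.1.2 : ℝ) : ℂ) :=
    Complex.continuous_ofReal.comp ((continuous_fst.comp continuous_fst).min (continuous_snd.comp continuous_fst))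
  have h2 : Continuous fun q : (ℝ × ℝ) × ℝ ↦ ((max q.1.1 q.1.2 : ℝ) : ℂ) :=
    Complex.continuous_ofReal.comp ((continuous_fst.comp continuous_fst).max (continuous_snd.comp continuous_fst))
  have hne : ∀ q : (ℝ × ℝ) × ℝ, Complex.I - ((max q.1.1 q.1.2 : ℝ) : ℂ) ≠ 0 := fun q h ↦ by
    have := congrArg Complex.im h
    simp at this
  unfold excInv
  exact (Complex.continuous_ofReal.comp continuous_snd).mul ((h1.sub continuous_const).div (continuous_const.sub h2) hne)

/-- The good parameters form an open set. [folklore] -/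
theorem isOpen_goodParams : IsOpen goodParams := by
  have h1 : IsOpen {q : (ℝ × ℝ) × ℝ | q.1 ∈ feetSquare} := isOpen_feetSquare.preimage continuous_fst
  have h2 : IsOpen {q : (ℝ × ℝ) × ℝ | q.1.1 ≠ q.1.2} :=
    isOpen_ne_fun (continuous_fst.comp continuous_fst) (continuous_snd.comp continuous_fst)
  have h3 : IsOpen {q : (ℝ × ℝ) × ℝ | q.2 ∈ Ioo (0 : ℝ) 1} := isOpen_Ioo.preimage continuous_snd
  have : goodParams = {q : (ℝ × ℝ) × ℝ | q.1 ∈ feetSquare} ∩ ({q | q.1.1 ≠ q.1.2} ∩ {q | q.2 ∈ Ioo (0 : ℝ) 1}) := by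
    ext q
    simp [goodParams]
  rw [this]
  exact h1.inter (h2.inter h3)

/-- **A nonempty open set of good parameters has positive parameter measure** (`β > 0`): the
parameter measure dominates Lebesgue measure on the good parameters (its density is positive off
the diagonal). [folklore] -/
theorem paramMeasure_pos_of_isOpen {β : ℝ} (hβ : 0 < β) {U : Set ((ℝ × ℝ) × ℝ)} (hU : IsOpen U)
    (hUg : U ⊆ goodParams) (hne : U.Nonempty) : 0 < paramMeasure β U := by
  -- Lebesgue ≪ parameter measure on `feetSquare × (0, 1)`
  have hdens : ∀ᵐ p ∂(volume.restrict feetSquare), feetDensity β p ≠ 0 := by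
    refine ae_restrict_of_ae ?_
    rw [ae_iff]
    refine measure_mono_null (fun p hp ↦ ?_) volume_diagonal_real
    simp only [mem_setOf_eq, not_not, feetDensity, ENNReal.ofReal_eq_zero] at hp ⊢
    by_contra hne'
    have : 0 < β * ((p.1 - p.2) ^ 2)⁻¹ := mul_pos hβ (inv_pos.2 (by positivity))
    linarith
  have hac : (volume.restrict feetSquare).prod (volume.restrict (Ioo (0 : ℝ) 1)) ≪ paramMeasure β :=
    (withDensity_absolutelyContinuous' (measurable_feetDensity β).aemeasurable hdens).prod
      Measure.AbsolutelyContinuous.rfl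
  refine pos_iff_ne_zero.2 fun h0 ↦ ?_
  have h1 := hac h0
  rw [Measure.prod_restrict, ← Measure.volume_eq_prod, Measure.restrict_apply' (measurableSet_feetSquare.prod measurableSet_Ioo),
    inter_eq_left.2 (fun q hq ↦ Set.mem_prod.2 ⟨(hUg hq).1, (hUg hq).2.2⟩)] at h1
  exact (hU.measure_pos volume hne).ne' h1

variable {Ω' : Type*} [MeasurableSpace Ω'] {P' : Measure Ω'} {X : Ω' → Set (((ℝ × ℝ) × ℝ) × RestrictionConfig)}
  {β : ℝ}

omit [MeasurableSpace Ω'] in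
/-- A cloud point whose hung sample carries `i` puts `i` into the left-filled cloud. [folklore] -/
theorem I_mem_cloudConfig_of_mem {ω : Ω'} (hω : ω ∈ goodSet X) {e : ((ℝ × ℝ) × ℝ) × RestrictionConfig} (he : e ∈ X ω)
    (hI : (e.1.2 : ℂ) * excInv (min e.1.1.1 e.1.1.2) (max e.1.1.1 e.1.1.2) Complex.I ∈ (e.2 : Set ℂ)) :
    Complex.I ∈ ((cloudConfig X ω : RightConfig) : Set ℂ) := by
  obtain ⟨hxy, hy, ha, -⟩ := goodParams_lt (hω.1 e he)
  rw [coe_cloudConfig hω]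
  refine inter_subset_leftFilling _ ⟨Or.inr (mem_iUnion₂.2 ⟨e, he, ?_⟩), by simp⟩
  refine ⟨excInv (min e.1.1.1 e.1.1.2) (max e.1.1.1 e.1.1.2) Complex.I, ?_, excMap_excInv hxy.ne
    (ne_ofReal_of_mem_upperHalfPlaneSet (show (Complex.I : ℂ) ∈ upperHalfPlaneSet by simp [upperHalfPlaneSet]) _)⟩
  have : excInv (min e.1.1.1 e.1.1.2) (max e.1.1.1 e.1.1.2) Complex.I =
      e.1.2⁻¹ • ((e.1.2 : ℂ) * excInv (min e.1.1.1 e.1.1.2) (max e.1.1.1 e.1.1.2) Complex.I) := by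
    rw [Complex.real_smul, ← mul_assoc, show ((e.1.2⁻¹ : ℝ) : ℂ) * (e.1.2 : ℂ) = 1 by
      rw [Complex.ofReal_inv, inv_mul_cancel₀ (by exact_mod_cast ha.ne')], one_mul]
  rw [this]
  exact Set.smul_mem_smul_set hI

/-- **`P'{i ∈ left-filled cloud} > 0`** ([Law05] proof of Cor. 9.11: "The construction above shows
that `q(α) ∈ (0, 1)`" — the positivity half): a disc `B₀` of the open left quadrant lies in the
sample with positive `P`-probability (`exists_ball_re_neg_charged`), the parameters carrying `i`
into `B₀` form a nonempty open set `U` (`exists_goodParams_eq`), and the cloud has a point in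
`U × {B₀ ⊆ K}` with probability `1 − exp(−Λ_β(U × {B₀ ⊆ K})) > 0`. [cite: Lawler2005, Cor. 9.11 (proof, p. 219) with §9.2 Prop. 9.13] -/
theorem measure_I_mem_cloudConfig_pos (hP : IsRestrictionMeasure 1 P)
    (hint : ∀ᵐ K : RestrictionConfig ∂P, (interior (K : Set ℂ)).Nonempty)
    (hβ : 0 < β) (hX : IsPoissonCloud (cloudIntensity β P) X P') :
    0 < P' {ω | Complex.I ∈ ((cloudConfig X ω : RightConfig) : Set ℂ)} := by
  haveI := hP.isProbabilityMeasure
  haveI := hX.isProbabilityMeasure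
  obtain ⟨q₀, r₀, hr₀, hsub, hVpos⟩ := exists_ball_re_neg_charged hP hint
  -- `q₀ ∈ ℍ`: some configuration contains the disc
  have hq₀ : 0 < q₀.im := by
    obtain ⟨K, hK⟩ := nonempty_of_measure_ne_zero hVpos.ne'
    exact K.subset_upperHalfPlaneSet (hK (mem_ball_self hr₀))
  obtain ⟨qs, hqs, hζ⟩ := exists_goodParams_eq (hsub (mem_ball_self hr₀)) hq₀
  set ζ : (ℝ × ℝ) × ℝ → ℂ := fun q ↦ (q.2 : ℂ) * excInv (min q.1.1 q.1.2) (max q.1.1 q.1.2) Complex.I with hζdef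
  set U : Set ((ℝ × ℝ) × ℝ) := goodParams ∩ ζ ⁻¹' ball q₀ r₀ with hU
  set V : Set RestrictionConfig := {K | ball q₀ r₀ ⊆ (K : Set ℂ)} with hV
  have hUo : IsOpen U := isOpen_goodParams.inter (continuous_hungPoint_I.isOpen_preimage _ isOpen_ball)
  have hUne : U.Nonempty := ⟨qs, hqs, by rw [mem_preimage, hζdef]; simp only; rw [hζ]; exact mem_ball_self hr₀⟩
  have hUm : MeasurableSet U := hUo.measurableSet
  have hVm : MeasurableSet V := RestrictionConfig.measurableSet_ball_subset q₀ r₀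
  have hs : MeasurableSet (U ×ˢ V) := hUm.prod hVm
  -- a cloud point in `U × V` puts `i` in the cloud
  have hkey : {ω | X ω ∩ (U ×ˢ V) ≠ ∅} ∩ goodSet X ⊆ {ω | Complex.I ∈ ((cloudConfig X ω : RightConfig) : Set ℂ)} := by
    rintro ω ⟨hne, hω⟩
    obtain ⟨e, he, heU, heV⟩ := nonempty_iff_ne_empty.2 hne
    exact I_mem_cloudConfig_of_mem hω he (heV (mem_preimage.1 heU.2))
  -- the probability of a cloud point in `U × V` is positive
  have hΛpos : 0 < cloudIntensity β P (U ×ˢ V) := by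
    rw [cloudIntensity_prod]
    exact ENNReal.mul_pos (paramMeasure_pos_of_isOpen hβ hUo inter_subset_left hUne).ne' hVpos.ne'
  have hempty : P' {ω | X ω ∩ (U ×ˢ V) = ∅} < 1 := by
    by_cases htop : cloudIntensity β P (U ×ˢ V) = ∞
    · have hae := hX.ae_encard_eq_top hs htop
      have h0 : P' {ω | X ω ∩ (U ×ˢ V) = ∅} = 0 := by
        rw [ae_iff] at hae
        refine measure_mono_null (fun ω hω ↦ ?_) hae
        simp only [mem_setOf_eq] at hω ⊢
        rw [hω]
        simp
      rw [h0]
      exact zero_lt_one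
    · rw [hX.measure_inter_eq_empty hs htop]
      rw [← ENNReal.ofReal_one]
      refine (ENNReal.ofReal_lt_ofReal_iff zero_lt_one).2 ?_
      rw [Real.exp_lt_one_iff]
      exact neg_neg_of_pos (ENNReal.toReal_pos hΛpos.ne' htop)
  have hpos : 0 < P' {ω | X ω ∩ (U ×ˢ V) ≠ ∅} := by
    have : {ω | X ω ∩ (U ×ˢ V) ≠ ∅} = {ω | X ω ∩ (U ×ˢ V) = ∅}ᶜ := rfl
    rw [this, prob_compl_eq_one_sub (hX.measurableSet_inter_eq_empty hs)]
    exact tsub_pos_iff_lt.2 hempty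
  -- discard the null set of bad samples
  have hgood : P' (goodSet X)ᶜ = 0 := by
    have := ae_mem_goodSet hP hβ.le hX
    rwa [ae_iff] at this
  calc (0 : ℝ≥0∞) < P' {ω | X ω ∩ (U ×ˢ V) ≠ ∅} := hpos
    _ = P' ({ω | X ω ∩ (U ×ˢ V) ≠ ∅} ∩ goodSet X) := (measure_inter_conull hgood).symm
    _ ≤ _ := measure_mono hkey

end Positivity

/-! ### Conclusions: `P⁺_β` exists for every `β > 0`, and charges `i` -/

section Final

/-- **[LSW] Prop. 8.1 / [Law05] Thm. 9.8 with Prop. 9.13 — `P⁺_β` exists for every `β > 0`**,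
given ANY two-sided restriction measure of exponent `1` (in [Law05] the filled Brownian excursion
`P_1`): the law of the left-filled Poissonian cloud of hung samples with intensity `Λ_β`
(Kingman's existence theorem, the tree's `exists_isPoissonCloud_holds`).
[cite: Lawler2005, §9.2 Thm. 9.8 and Prop. 9.13 (p. 220)] -/
theorem exists_isRightRestrictionMeasure_of_exists_one
    (h1 : ∃ P : Measure RestrictionConfig, IsRestrictionMeasure 1 P) {β : ℝ} (hβ : 0 < β) :
    ∃ Q : Measure RightConfig, IsRightRestrictionMeasure β Q := by
  obtain ⟨P, hP⟩ := h1
  haveI := hP.isProbabilityMeasure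
  obtain ⟨Ω', _, P', X, hX⟩ := exists_isPoissonCloud_holds (cloudIntensity β P) measurableSet_diagonal_cloudSpace
    inferInstance (cloudIntensity_singleton β P)
  exact ⟨_, isRightRestrictionMeasure_map_cloudConfig hP hβ.le hX⟩

/-- **For every `β > 0` some right-sided restriction measure of exponent `β` charges `i`:
`P⁺_β{i ∉ K} < 1`** ([Law05] proof of Cor. 9.11: "The construction above shows that
`q(α) ∈ (0, 1)`"), given a two-sided restriction measure of exponent `1` almost every sample of
which has an interior point ([LSW] Thm. 7.3 at `κ = 2`; in the tree
`exists_isRestrictionMeasure_ae_interior_nonempty_of_three_leaves`).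
[cite: Lawler2005, Cor. 9.11 (proof, p. 219) with §9.2 Prop. 9.13 (p. 220)] -/
theorem exists_isRightRestrictionMeasure_charging_I
    (h1 : ∃ P : Measure RestrictionConfig, IsRestrictionMeasure 1 P ∧
      ∀ᵐ K : RestrictionConfig ∂P, (interior (K : Set ℂ)).Nonempty) {β : ℝ} (hβ : 0 < β) :
    ∃ Q : Measure RightConfig, IsRightRestrictionMeasure β Q ∧
      Q {K : RightConfig | Complex.I ∉ (K : Set ℂ)} < 1 := by
  obtain ⟨P, hP, hint⟩ := h1
  haveI := hP.isProbabilityMeasure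
  obtain ⟨Ω', _, P', X, hX⟩ := exists_isPoissonCloud_holds (cloudIntensity β P) measurableSet_diagonal_cloudSpace
    inferInstance (cloudIntensity_singleton β P)
  haveI := hX.isProbabilityMeasure
  have hmeas := measurable_cloudConfig hX (P := P)
  refine ⟨P'.map (cloudConfig X), isRightRestrictionMeasure_map_cloudConfig hP hβ.le hX, ?_⟩
  have hI : (Complex.I : ℂ) ∈ upperHalfPlaneSet := by simp [upperHalfPlaneSet]
  rw [Measure.map_apply hmeas (RightConfig.measurableSet_notMem hI)]
  have hset : cloudConfig X ⁻¹' {K : RightConfig | Complex.I ∉ (K : Set ℂ)} =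
      {ω | Complex.I ∈ ((cloudConfig X ω : RightConfig) : Set ℂ)}ᶜ := by
    ext ω
    simp
  have hm : MeasurableSet {ω | Complex.I ∈ ((cloudConfig X ω : RightConfig) : Set ℂ)} := by
    have := (hmeas (RightConfig.measurableSet_notMem hI)).compl
    rwa [hset, compl_compl] at this
  rw [hset, prob_compl_eq_one_sub hm]
  exact ENNReal.sub_lt_self ENNReal.one_ne_top one_ne_zero (measure_I_mem_cloudConfig_pos hP hint hβ hX).ne'

/-- The same in the `ε`-form consumed by the tree's reductions of the comparison sentence of
[LSW] p. 38 (`SLEKappaRho.measure_I_notMem_fill_lt_of_neg_of_martingale_of_pos`,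
`IsRightRestrictionMeasure.one_half_lt_measure_notMem_I_of_pos`): for every `ε > 0` some `P⁺_β`,
`0 < β ≤ ε`, gives `{i ∉ K}` probability `< 1`. [cite: Lawler2005, Cor. 9.11 (proof, p. 219)] -/
theorem small_exponent_positivity
    (h1 : ∃ P : Measure RestrictionConfig, IsRestrictionMeasure 1 P ∧
      ∀ᵐ K : RestrictionConfig ∂P, (interior (K : Set ℂ)).Nonempty) :
    ∀ ε : ℝ, 0 < ε → ∃ (β : ℝ) (Q : Measure RightConfig), 0 < β ∧ β ≤ ε ∧
      IsRightRestrictionMeasure β Q ∧ Q {K : RightConfig | Complex.I ∉ (K : Set ℂ)} < 1 := by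
  intro ε hε
  obtain ⟨Q, hQ, hlt⟩ := exists_isRightRestrictionMeasure_charging_I h1 hε
  exact ⟨ε, Q, hε, le_rfl, hQ, hlt⟩

end Final

end ExcursionCloud

end Literature.Probability.RandomPlanarGeometry

end
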